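import Summits.KontsevichZagierPeriods.KontsevichZagierPeriods.Theses.HurwitzMicroSectors
import Summits.KontsevichZagierPeriods.KontsevichZagierPeriods.Theorems.HurwitzMicroSectorsNormalFormPrinciplePiBoxTransfer
import Summits.KontsevichZagierPeriods.KontsevichZagierPeriods.Theorems.HurwitzMicroSectorsNormalFormPrincipleVariants2320
import Summits.KontsevichZagierPeriods.KontsevichZagierPeriods.Theorems.HurwitzMicroSectorsNormalFormPrincipleVariants2283

/-! TTRL-lite variant V2293 of stmt-KontsevichZagierPeriods-3869

Variant V2293 = `stub_boxRigidity` (BoxRigidity: two box-rational representations — domain the open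
unit box, integrand `p/q` over `ℚ` — with equal values are KZ-equivalent) under the move
`fix_nat:m=5; bound_nat:m'≤5` (left dimension frozen to `5`, right dimension `m' ≤ 5`). Verdict of the
attempt seat: **open** — this file is the exact-strength certificate, not a proof of the variant.
By the tree's general fact `boxRigidityFixBound_iff_boxVanishing` (file `…Variants2320`: freezing one
dimension to `K` and bounding the other by `b ≤ K` is exactly BoxVanishing in dimension `K`), V2293 is
**BoxVanishing(`5`)** — every box-rational representation on `(0,1)⁵` of value `0` is a relation
(`stub_boxRigidity_var2293_iff_boxVanishing_five`) —, equivalently BoxRigidity under the joint bound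
`m, m' ≤ 5` (`stub_boxRigidity_var2293_iff_le_five`), and it coincides with the sibling V2283
(`fix_nat:m=5; fix_nat:m'=2`, `stub_boxRigidity_var2293_iff_var2283`). That is Conjecture 1 of
Kontsevich–Zagier for all pairs of rational integrands on the boxes `(0,1)^{≤ 5}` (periods `π²`, `π⁴`,
`ζ(3)`, `ζ(5)`, `ζ(2)ζ(3)`, Catalan's `G`, `Li₂` at rationals, …; e.g. for `[1/(1 − x₁⋯x₅)]` against a
rational constant `[q]` the case split is `ζ(5) = q`), which nothing in the tree or in print proves; the
proved two-sided instance is `m, m' ≤ 1` (`boxRigidity_of_le_one`, Baker). Upward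
`KontsevichZagierPeriods ⇒ parent ⇒ V2293` (`stub_boxRigidity_var2293_of_statement`), so a refutation of
the variant would refute the Summit, and the tree has no invariant of `KZ.relations` finer than `eval`.
Source: M. Kontsevich, D. Zagier, *Periods* (2001), §1.2 Conjecture 1. Pure proof file, no definitions. -/

-- `Summit.<Summit>.<Problem>` is the tree's mandated summit-side namespace (CONVENTIONS §2); for this
-- single-conjunct summit the two coincide, so the duplicate is deliberate.
set_option linter.dupNamespace false

noncomputable section

namespace Summit.KontsevichZagierPeriods.KontsevichZagierPeriods.Theorems

open MeasureTheory Set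
open Literature.NumberTheory.Transcendental Literature.NumberTheory.Transcendental.KZ
open Summit.KontsevichZagierPeriods.KontsevichZagierPeriods.Theses.HurwitzMicroSectors
open Summit.KontsevichZagierPeriods.HurwitzMicroSectors.NormalFormPrinciple.PiBox

/-! ## The variant V2293 is exactly `BoxVanishing 5` -/

/-- **V2293 ⟺ BoxVanishing in dimension `5`** (every box-rational representation on `(0,1)⁵` of value
`0` is a KZ relation): instance `K = b = 5` of `boxRigidityFixBound_iff_boxVanishing` — forward by
comparison with the zero representation on the `0`-box, backward by padding to `(0,1)⁵` and subtracting.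
[cite: KontsevichZagier2001, §1.2 Conjecture 1] -/
theorem stub_boxRigidity_var2293_iff_boxVanishing_five :
    (∀ (m' : ℕ) (N : IntegralRep 5) (N' : IntegralRep m'), m' ≤ 5 → N.domain = {x | ∀ i, x i ∈ Set.Ioo (0:ℝ) 1} → N.IsRational → N'.domain = {x | ∀ i, x i ∈ Set.Ioo (0:ℝ) 1} → N'.IsRational → N.value = N'.value → Equivalent N N') ↔
    (∀ (N : IntegralRep 5), N.domain = {x | ∀ i, x i ∈ Set.Ioo (0:ℝ) 1} → N.IsRational →
      N.value = 0 → of N ∈ relations) :=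
  boxRigidityFixBound_iff_boxVanishing le_rfl

/-- **V2293 ⟺ BoxRigidity under the joint bound `m, m' ≤ 5`** (the honest strength of the variant:
Conjecture 1 for all pairs of rational integrands on the open unit boxes of dimension at most `5`;
freezing `m := 5` loses nothing against the bound `m' ≤ 5`). [cite: KontsevichZagier2001, §1.2 Conjecture 1] -/
theorem stub_boxRigidity_var2293_iff_le_five :
    (∀ (m' : ℕ) (N : IntegralRep 5) (N' : IntegralRep m'), m' ≤ 5 → N.domain = {x | ∀ i, x i ∈ Set.Ioo (0:ℝ) 1} → N.IsRational → N'.domain = {x | ∀ i, x i ∈ Set.Ioo (0:ℝ) 1} → N'.IsRational → N.value = N'.value → Equivalent N N') ↔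
    (∀ (m m' : ℕ) (N : IntegralRep m) (N' : IntegralRep m'), m' ≤ 5 → m ≤ 5 →
      N.domain = {x | ∀ i, x i ∈ Set.Ioo (0:ℝ) 1} → N.IsRational →
      N'.domain = {x | ∀ i, x i ∈ Set.Ioo (0:ℝ) 1} → N'.IsRational →
      N.value = N'.value → Equivalent N N') :=
  ⟨fun h => boxRigidityLe_of_boxVanishing (j := 5) (k := 5) le_rfl le_rfl
      (stub_boxRigidity_var2293_iff_boxVanishing_five.1 h),
    fun h m' N N' hm' => h 5 m' N N' hm' le_rfl⟩

/-- **V2293 ⟺ the sibling V2283** (`fix_nat:m=5; fix_nat:m'=2`): both are `BoxVanishing 5`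
(`stub_boxRigidity_var2283_iff_boxVanishing_five`, file `…Variants2283`). [cite: KontsevichZagier2001, §1.2 Conjecture 1] -/
theorem stub_boxRigidity_var2293_iff_var2283 :
    (∀ (m' : ℕ) (N : IntegralRep 5) (N' : IntegralRep m'), m' ≤ 5 → N.domain = {x | ∀ i, x i ∈ Set.Ioo (0:ℝ) 1} → N.IsRational → N'.domain = {x | ∀ i, x i ∈ Set.Ioo (0:ℝ) 1} → N'.IsRational → N.value = N'.value → Equivalent N N') ↔
    (∀ (N : IntegralRep 5) (N' : IntegralRep 2), N.domain = {x | ∀ i, x i ∈ Set.Ioo (0:ℝ) 1} → N.IsRational → N'.domain = {x | ∀ i, x i ∈ Set.Ioo (0:ℝ) 1} → N'.IsRational → N.value = N'.value → Equivalent N N') :=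
  stub_boxRigidity_var2293_iff_boxVanishing_five.trans
    stub_boxRigidity_var2283_iff_boxVanishing_five.symm

/-- **V2293 ⇒ BoxVanishing in every dimension `≤ 5`** (monotonicity along padding,
`boxVanishing_mono`); the first open level is `2` (every vanishing absolutely convergent
`∫∫_{(0,1)²} p/q`, `p/q ∈ ℚ(x, y)`, is generated by the four moves: Catalan / dilogarithm relations).
[cite: KontsevichZagier2001, §1.2 Conjecture 1] -/
theorem boxVanishing_le_five_of_stub_boxRigidity_var2293
    (h : ∀ (m' : ℕ) (N : IntegralRep 5) (N' : IntegralRep m'), m' ≤ 5 → N.domain = {x | ∀ i, x i ∈ Set.Ioo (0:ℝ) 1} → N.IsRational → N'.domain = {x | ∀ i, x i ∈ Set.Ioo (0:ℝ) 1} → N'.IsRational → N.value = N'.value → Equivalent N N')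
    {m : ℕ} (hm : m ≤ 5) (N : IntegralRep m) (hNd : N.domain = {x | ∀ i, x i ∈ Set.Ioo (0:ℝ) 1})
    (hNr : N.IsRational) (hv : N.value = 0) : of N ∈ relations :=
  boxVanishing_mono hm (stub_boxRigidity_var2293_iff_boxVanishing_five.1 h) N hNd hNr hv

/-- **The parent leaf ⇒ V2293** (specialisation `m := 5`, the bound `m' ≤ 5` is dropped; the converse
is not claimed — the parent is `BoxVanishing` in ALL dimensions). [cite: KontsevichZagier2001, §1.2 Conjecture 1] -/
theorem stub_boxRigidity_var2293_of_parent
    (h : ∀ (m m' : ℕ) (N : IntegralRep m) (N' : IntegralRep m'), N.domain = {x | ∀ i, x i ∈ Set.Ioo (0:ℝ) 1} → N.IsRational → N'.domain = {x | ∀ i, x i ∈ Set.Ioo (0:ℝ) 1} → N'.IsRational → N.value = N'.value → Equivalent N N') :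
    ∀ (m' : ℕ) (N : IntegralRep 5) (N' : IntegralRep m'), m' ≤ 5 → N.domain = {x | ∀ i, x i ∈ Set.Ioo (0:ℝ) 1} → N.IsRational → N'.domain = {x | ∀ i, x i ∈ Set.Ioo (0:ℝ) 1} → N'.IsRational → N.value = N'.value → Equivalent N N' :=
  fun m' N N' _ => h 5 m' N N'

/-- **`KontsevichZagierPeriods ⇒ V2293`**: the variant is a special case of Conjecture 1 for the
tree's calculus (`leaves_of_statement`) — so a refutation of the variant would refute the Summit.
[cite: KontsevichZagier2001, §1.2 Conjecture 1] -/
theorem stub_boxRigidity_var2293_of_statement (h : _root_.KontsevichZagierPeriods) :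
    ∀ (m' : ℕ) (N : IntegralRep 5) (N' : IntegralRep m'), m' ≤ 5 → N.domain = {x | ∀ i, x i ∈ Set.Ioo (0:ℝ) 1} → N.IsRational → N'.domain = {x | ∀ i, x i ∈ Set.Ioo (0:ℝ) 1} → N'.IsRational → N.value = N'.value → Equivalent N N' :=
  stub_boxRigidity_var2293_of_parent (leaves_of_statement h).1

end Summit.KontsevichZagierPeriods.KontsevichZagierPeriods.Theorems

end
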